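/-
Copyright (c) 2026 the pub-hodgecm-mathlib formalisation cell (harness21).  Prover seat hodgecm-mathlib-LH4-p02 (g8): LH4-plan (g6) WORD #89 (P2h) ‹RANK-deep›, FILE A
(generic field half) — FINDING #9 ∕ Q-D1 memo `F0/P3c/LH4/LH4-p02/g8/MEMO-QD1-second-test-function.v1.md` §(ii)(a); 2026-09-02.
-/
import Literature.NumberTheory.Automorphic.UnitaryThreeUnipotentClassesUnramified   -- ★ FILE 1 (F0P3a-p08): entry formula, level-0 parity, same-parity ⇒ conjugate, the four classes
import HarnessLib

/-!
# Transvection conjugates of `U(3)` at ANY depth: the CONTENT `|t|·M²` of `k·n(t)·k⁻¹ − 1`, the parity law «the class of `n(t)` meets the shell of level `m` iff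
# `m ≡ ord t (mod 2)`», and the singular unipotent classes as `[n(ϖ^m δ)] ⊔ [n(ϖ^{m+1} δ)]` for every `m` (Rogawski 1990 §3.9, §8.1)

Topic `NumberTheory/Automorphic`; namespace `Literature.NumberTheory.Automorphic.UnitaryGroup`.  THEOREMS ONLY (no definition, no instance, no notation, no named fact,
no `sorry`; axioms ⊆ {propext, Classical.choice, Quot.sound}).  Cell `pub/hodgecm-mathlib` (D-0151), crux H413 = `stmt-HodgeConjecture-24833`; half A line LH4, DYADIC
pay-down leaf `Cruxes/H413/Lines/F0_P3c_DyadicPaydown.lean`, organ (D-UNR) (PRINT by D74′).  LH4-plan (g6) FINDING #9 ∕ Q-D1: at a dyadic hyperspecial place the identity core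
cannot use the tame reference pieces of levels `≤ 2` (the Möbius lift `K₂ → K₁` is impossible, FINDING #7); the replacement ‹RANK-deep› uses pieces at levels `m, m+1, m+2`
for any `m`, and THIS FILE is its field half: the generic-depth twin of ★ FILE 1 `UnitaryThreeUnipotentClassesUnramified` §2∕§4∕§5 (which is the case `m = 0`).  2-free,
residue-characteristic-free.  HONEST LABEL: HC_CM is proved only modulo the 7 printed citations (2 remaining named inputs: hLiu418 = stmt-HodgeConjecture-24832, h413 =
stmt-HodgeConjecture-24833) until rung 0 closes; BANKED base layer (consumer = the CM packaging `exists_deepLevelPieces_det_classOrbitalIntegral_ne_zero`, FILE B, not yet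
typed); count-neutral, pays no organ, opens no road.

SETTING (= ★ FILE 1).  `K` a field with `[Valued K ℤᵐ⁰]`, `σ : K →+* K` with `|σ a| = |a|` (`hvσ`), the unitary group `U(σ, J₀) = unitaryGroupOfForm σ ((StdForm.antidiagonal 3).over K)`,
the transvection `n(t) = !![1, 0, t; 0, 1, 0; 0, 0, 1]` (`σt + t = 0` for membership), LEVEL of `g`: «every entry of `g − 1` has `|·| ≤ c`»; the SHELL of level `m ∈ ℤ` =
level `exp(−m)` but not level `exp(−(m+1))`.  Unramified datum `UnramifiedLocalConjDatum σ ϖ` (`σσ = id`, `σϖ = ϖ`, `|ϖ| = exp(−1)`), `hnormU` «every `σ`-fixed unit is a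
norm», `δ` a `σ`-skew unit.

* §1 CONTENT.  `exists_forall_v_conj_cornerUnipotent_sub_one_apply_le_iff`: for `k ∈ U(σ, J₀)` there is `M = max_i |k_{i0}| ≠ 0` with
  «`k n(t) k⁻¹ − 1` has level `c` ⟺ `|t|·M·M ≤ c`» for every `c` (★ entry formula `|(k n(t) k⁻¹ − 1)_{ij}| = |t|·|k_{i0}|·|k_{rev j,0}|`).
* §2 PARITY AT ANY DEPTH.  **`even_add_of_conj_cornerUnipotent_mem_shell`**: `|t| = exp n` and `k n(t) k⁻¹` in the shell of level `m` ⇒ `Even (n + m)` (the content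
  `|t|·M²` is `exp(−m)` and `M² ∈ exp(2ℤ)`); contrapositive `forall_v_conj_cornerUnipotent_sub_one_apply_le_exp_of_odd` (`Odd (n + m)`, level `m` ⇒ level `m + 1`; ★ FILE 1
  `v_conj_cornerUnipotent_sub_one_apply_lt_one` is `n = −1, m = 0`); `not_exists_conj_cornerUnipotent_of_odd` (`n(t) ≁ n(t′)` when `ord t ≢ ord t′`); and the converse
  under the unramified datum: **`exists_conj_cornerUnipotent_mem_shell_iff`** — the class of `n(t)` MEETS the shell of level `m` iff `Even (n + m)` (`⇐`: `n(t·ϖ^{n+m})`, same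
  parity ⇒ conjugate by ★ `exists_conj_cornerUnipotent_of_v_eq_mul_exp`).
* §3 REPRESENTATIVES AT DEPTH `m`.  `v_pow_mul_of_unramifiedLocalConjDatum` (`|ϖ^j δ| = exp(−j)`), `cornerUnipotent_pow_mul_facts` (`n(ϖ^j δ) ∈ U(σ, J₀)`, integral, square-zero,
  in the shell of level `j`), and **`sq_zero_unipotent_cases_level (m : ℕ)`**: every square-zero unipotent of `U(σ, J₀)` is `1` or conjugate to `n(ϖ^m δ)` or to `n(ϖ^{m+1} δ)`
  (★ `sq_zero_unipotent_cases` = `m = 0`, rescaled by ★ §3), the two being NON-conjugate (`not_exists_conj_cornerUnipotent_pow_succ`).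
USE.  With the reference pieces `{1_R, 1_{K(m)∖K(m+1)}, 1_{K(m+1)∖K(m+2)}, 1_{K(m+2)}}` the unipotent orbital-integral table of `U(3)` at an unramified non-split place is
lower-triangular with non-zero diagonal for EVERY `m` (FILE B; the tame ★ `exists_levelPieces_det_classOrbitalIntegral_ne_zero` is `m = 0`): `1` misses the three shells,
the transvection classes miss `R`, and §2 is the one non-trivial vanishing «`[n(ϖ^{m+1}δ)]` misses the shell `m`».

## References
* [Rogawski1990] J. D. Rogawski, *Automorphic Representations of Unitary Groups in Three Variables*, Ann. of Math. Stud. 123 (1990): §3.9 p. 32 (Prop. 3.9.1, the classes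
  `t mod N E^×`), §1.10 p. 9 (`n(t)`), §8.1 p. 112 (germs indexed by the unipotent classes).
* [Serre1979] J.-P. Serre, *Local Fields*, GTM 67 (1979), Ch. V §2 Prop. 3 (`U_F = N U_E`, unramified).
-/

set_option autoImplicit false

open scoped Matrix MatrixGroups Valued WithZero
open Matrix

namespace Literature.NumberTheory.Automorphic.UnitaryGroup

open Literature.NumberTheory.Automorphic.HermitianLattice Literature.NumberTheory.Automorphic.UnitaryLatticeTree

/-! ## §1 The content of a transvection conjugate -/

section Content

variable {K : Type*} [Field K] [Valued K ℤᵐ⁰] (σ : K →+* K)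

/-- **THE CONTENT OF `k n(t) k⁻¹ − 1`**: for `k ∈ U(σ, J₀)` there is `M = max_i |k_{i0}|` (`≠ 0`, attained at some `i₀`) such that, for every bound `c`,
«all entries of `k n(t) k⁻¹ − 1` have `|·| ≤ c`» ⟺ `|t|·M·M ≤ c` — the maximal entry is `(i₀, rev i₀)` with value `|t|·M²` (★ `v_conj_cornerUnipotent_sub_one_apply`).
[cite: Rogawski1990, §3.9 p. 32; §1.10 p. 9] -/
theorem exists_forall_v_conj_cornerUnipotent_sub_one_apply_le_iff (hvσ : ∀ a, Valued.v (σ a) = Valued.v a) {t : K} {u k : GL (Fin 3) K}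
    (hu : (u : Matrix (Fin 3) (Fin 3) K) = !![1, 0, t; 0, 1, 0; 0, 0, 1]) (hk : k ∈ unitaryGroupOfForm σ ((StdForm.antidiagonal 3).over K)) :
    ∃ M : ℤᵐ⁰, M ≠ 0 ∧ (∃ i₀, Valued.v ((k : Matrix (Fin 3) (Fin 3) K) i₀ 0) = M) ∧
      ∀ c : ℤᵐ⁰, (∀ i j, Valued.v ((((k * u * k⁻¹ : GL (Fin 3) K) : Matrix (Fin 3) (Fin 3) K) - 1) i j) ≤ c) ↔ Valued.v t * M * M ≤ c := by
  obtain ⟨i₀, hmax, hM0⟩ := exists_forall_v_apply_zero_le k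
  refine ⟨_, hM0, ⟨i₀, rfl⟩, fun c => ⟨fun h => ?_, fun h i j => ?_⟩⟩
  · have h0 := h i₀ (Fin.rev i₀)
    rwa [v_conj_cornerUnipotent_sub_one_apply σ hvσ hu hk, Fin.rev_rev] at h0
  · rw [v_conj_cornerUnipotent_sub_one_apply σ hvσ hu hk]
    exact (mul_le_mul' (mul_le_mul' le_rfl (hmax i)) (hmax (Fin.rev j))).trans h

/-! ## §2 Parity at any depth -/

/-- **PARITY OF A TRANSVECTION CONJUGATE IN A SHELL**: if `|t| = exp n`, `k ∈ U(σ, J₀)`, and `k n(t) k⁻¹ − 1` has all entries `≤ exp(−m)` but NOT all `≤ exp(−(m+1))` (the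
conjugate lies in the SHELL of level `m`), then `n + m` is EVEN — the content `|t|·M²` equals `exp(−m)` and `M² = exp(2ℓ)`.  The class of `n(t)` meets only the shells of the
parity of `ord t`. [cite: Rogawski1990, §3.9 p. 32; §8.1 p. 112] -/
theorem even_add_of_conj_cornerUnipotent_mem_shell (hvσ : ∀ a, Valued.v (σ a) = Valued.v a) {t : K} {n : ℤ} (ht : Valued.v t = WithZero.exp n)
    {u k : GL (Fin 3) K} (hu : (u : Matrix (Fin 3) (Fin 3) K) = !![1, 0, t; 0, 1, 0; 0, 0, 1]) (hk : k ∈ unitaryGroupOfForm σ ((StdForm.antidiagonal 3).over K))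
    {m : ℤ} (hle : ∀ i j, Valued.v ((((k * u * k⁻¹ : GL (Fin 3) K) : Matrix (Fin 3) (Fin 3) K) - 1) i j) ≤ WithZero.exp (-m))
    (hnot : ¬ ∀ i j, Valued.v ((((k * u * k⁻¹ : GL (Fin 3) K) : Matrix (Fin 3) (Fin 3) K) - 1) i j) ≤ WithZero.exp (-(m + 1))) : Even (n + m) := by
  obtain ⟨M, hM0, -, hiff⟩ := exists_forall_v_conj_cornerUnipotent_sub_one_apply_le_iff σ hvσ hu hk
  have h1 : Valued.v t * M * M ≤ WithZero.exp (-m) := (hiff _).1 hle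
  have h2 : ¬ Valued.v t * M * M ≤ WithZero.exp (-(m + 1)) := fun h => hnot ((hiff _).2 h)
  obtain ⟨ℓ, hℓ⟩ : ∃ ℓ : ℤ, M = WithZero.exp ℓ := ⟨WithZero.log M, (WithZero.exp_log hM0).symm⟩
  rw [ht, hℓ, ← WithZero.exp_add, ← WithZero.exp_add, WithZero.exp_le_exp] at h1 h2
  exact ⟨-ℓ, by omega⟩

/-- **ODD PARITY FORCES ONE LEVEL MORE**: `|t| = exp n`, `Odd (n + m)`, and `k n(t) k⁻¹ − 1` of level `m` ⇒ it is of level `m + 1` (the class of `n(t)` MISSES the shell `m`).  ★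
`v_conj_cornerUnipotent_sub_one_apply_lt_one` ∕ `…_le_exp_neg_one` are the case `n = −1, m = 0` («the odd transvection class misses `K ∖ K(1)`»). [cite: Rogawski1990, §3.9 p. 32; §8.1 p. 112] -/
theorem forall_v_conj_cornerUnipotent_sub_one_apply_le_exp_of_odd (hvσ : ∀ a, Valued.v (σ a) = Valued.v a) {t : K} {n : ℤ} (ht : Valued.v t = WithZero.exp n)
    {u k : GL (Fin 3) K} (hu : (u : Matrix (Fin 3) (Fin 3) K) = !![1, 0, t; 0, 1, 0; 0, 0, 1]) (hk : k ∈ unitaryGroupOfForm σ ((StdForm.antidiagonal 3).over K))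
    {m : ℤ} (hodd : Odd (n + m)) (hle : ∀ i j, Valued.v ((((k * u * k⁻¹ : GL (Fin 3) K) : Matrix (Fin 3) (Fin 3) K) - 1) i j) ≤ WithZero.exp (-m))
    (i j : Fin 3) : Valued.v ((((k * u * k⁻¹ : GL (Fin 3) K) : Matrix (Fin 3) (Fin 3) K) - 1) i j) ≤ WithZero.exp (-(m + 1)) := by
  by_contra hcon
  exact Int.not_even_iff_odd.2 hodd (even_add_of_conj_cornerUnipotent_mem_shell σ hvσ ht hu hk hle fun h => hcon (h i j))

/-- **`n(t)` LIES IN THE SHELL OF LEVEL `ord t`**: for `|t| = exp(−m)` all entries of `n(t) − 1` are `≤ exp(−m)` and not all `≤ exp(−(m+1))` (★ `forall_v_cornerUnipotent_sub_one_apply_le_iff`).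
[cite: Rogawski1990, §1.10 p. 9] -/
theorem forall_v_cornerUnipotent_sub_one_apply_le_and_not {t : K} {m : ℤ} (ht : Valued.v t = WithZero.exp (-m)) {u : GL (Fin 3) K}
    (hu : (u : Matrix (Fin 3) (Fin 3) K) = !![1, 0, t; 0, 1, 0; 0, 0, 1]) :
    (∀ a b, Valued.v (((u : Matrix (Fin 3) (Fin 3) K) - 1) a b) ≤ WithZero.exp (-m)) ∧
      ¬ ∀ a b, Valued.v (((u : Matrix (Fin 3) (Fin 3) K) - 1) a b) ≤ WithZero.exp (-(m + 1)) := by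
  rw [forall_v_cornerUnipotent_sub_one_apply_le_iff hu, forall_v_cornerUnipotent_sub_one_apply_le_iff hu, ht, WithZero.exp_le_exp, WithZero.exp_le_exp]
  omega

/-- **DIFFERENT PARITY ⇒ NOT CONJUGATE**: `|t| = exp n`, `|t′| = exp n′`, `Odd (n − n′)` ⇒ no `k ∈ U(σ, J₀)` has `k n(t) k⁻¹ = n(t′)` (`n(t′)` sits in the shell of level `−n′`,
of the wrong parity for the class of `n(t)`). [cite: Rogawski1990, §3.9 p. 32] -/
theorem not_exists_conj_cornerUnipotent_of_odd (hvσ : ∀ a, Valued.v (σ a) = Valued.v a) {t t' : K} {n n' : ℤ} (ht : Valued.v t = WithZero.exp n)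
    (ht' : Valued.v t' = WithZero.exp n') (hodd : Odd (n - n')) {u u' : GL (Fin 3) K}
    (hu : (u : Matrix (Fin 3) (Fin 3) K) = !![1, 0, t; 0, 1, 0; 0, 0, 1]) (hu' : (u' : Matrix (Fin 3) (Fin 3) K) = !![1, 0, t'; 0, 1, 0; 0, 0, 1]) :
    ¬ ∃ k : GL (Fin 3) K, k ∈ unitaryGroupOfForm σ ((StdForm.antidiagonal 3).over K) ∧ k * u * k⁻¹ = u' := by
  rintro ⟨k, hk, hconj⟩
  have ht'' : Valued.v t' = WithZero.exp (-(-n')) := by rw [neg_neg]; exact ht'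
  obtain ⟨hle, hnot⟩ := forall_v_cornerUnipotent_sub_one_apply_le_and_not ht'' hu'
  have hle' : ∀ i j, Valued.v ((((k * u * k⁻¹ : GL (Fin 3) K) : Matrix (Fin 3) (Fin 3) K) - 1) i j) ≤ WithZero.exp (-(-n')) := by
    rw [hconj]; exact hle
  have hnot' : ¬ ∀ i j, Valued.v ((((k * u * k⁻¹ : GL (Fin 3) K) : Matrix (Fin 3) (Fin 3) K) - 1) i j) ≤ WithZero.exp (-(-n' + 1)) := by
    rw [hconj]; exact hnot
  have heven := even_add_of_conj_cornerUnipotent_mem_shell σ hvσ ht hu hk hle' hnot'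
  rw [← sub_eq_add_neg] at heven
  exact Int.not_even_iff_odd.2 hodd heven

/-- **THE PARITY LAW (iff form, unramified datum)**: for a `σ`-skew `t ≠ 0` with `|t| = exp n`, the `U(σ, J₀)`-class of `n(t)` MEETS the shell of level `m` — some conjugate
`k n(t) k⁻¹` has all entries of `· − 1` `≤ exp(−m)` and not all `≤ exp(−(m+1))` — iff `Even (n + m)`.  (`⇐`: `t′ := t·ϖ^{n+m}` is `σ`-skew of valuation `exp(−m)` and
`|t′| = |t|·exp(2·(−(n+m)∕2))`, so `n(t) ∼ n(t′)` by ★ `exists_conj_cornerUnipotent_of_v_eq_mul_exp`, and `n(t′)` is in the shell `m`.) [cite: Rogawski1990, §3.9 p. 32; §8.1 p. 112]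
[cite: Serre1979, Ch. V §2 Prop. 3] -/
theorem exists_conj_cornerUnipotent_mem_shell_iff {ϖ : K} (hd : UnramifiedLocalConjDatum σ ϖ)
    (hnormU : ∀ x : K, σ x = x → Valued.v x = 1 → ∃ z : K, z * σ z = x)
    {t : K} (ht0 : t ≠ 0) (hσt : σ t = -t) {n : ℤ} (ht : Valued.v t = WithZero.exp n)
    {u : GL (Fin 3) K} (hu : (u : Matrix (Fin 3) (Fin 3) K) = !![1, 0, t; 0, 1, 0; 0, 0, 1]) (m : ℤ) :
    (∃ k : GL (Fin 3) K, k ∈ unitaryGroupOfForm σ ((StdForm.antidiagonal 3).over K) ∧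
      (∀ i j, Valued.v ((((k * u * k⁻¹ : GL (Fin 3) K) : Matrix (Fin 3) (Fin 3) K) - 1) i j) ≤ WithZero.exp (-m)) ∧
      ¬ ∀ i j, Valued.v ((((k * u * k⁻¹ : GL (Fin 3) K) : Matrix (Fin 3) (Fin 3) K) - 1) i j) ≤ WithZero.exp (-(m + 1))) ↔ Even (n + m) := by
  constructor
  · rintro ⟨k, hk, hle, hnot⟩
    exact even_add_of_conj_cornerUnipotent_mem_shell σ hd.vσ ht hu hk hle hnot
  · rintro ⟨r, hr⟩
    have hϖ0 : ϖ ≠ 0 := hd.ϖ_ne_zero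
    -- the rescaled parameter `t′ = t·ϖ^{n+m}`, of valuation `exp(−m)`, same parity
    obtain ⟨u', hu'⟩ := exists_units_coe_eq_cornerUnipotent' (t * ϖ ^ (n + m))
    have hσt' : σ (t * ϖ ^ (n + m)) = -(t * ϖ ^ (n + m)) := by rw [map_mul, map_zpow₀, hσt, hd.σϖ, neg_mul]
    have hvt' : Valued.v (t * ϖ ^ (n + m)) = WithZero.exp (-m) := by
      rw [map_mul, map_zpow₀, ht, hd.vϖ, ← WithZero.exp_zsmul, smul_eq_mul, ← WithZero.exp_add]
      congr 1; ring
    have hv : Valued.v (t * ϖ ^ (n + m)) = Valued.v t * WithZero.exp (2 * (-r)) := by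
      rw [hvt', ht, ← WithZero.exp_add]
      congr 1; omega
    obtain ⟨k, hk, hconj⟩ := exists_conj_cornerUnipotent_of_v_eq_mul_exp σ hd hnormU ht0 hσt hσt' (-r) hv hu hu'
    obtain ⟨hle, hnot⟩ := forall_v_cornerUnipotent_sub_one_apply_le_and_not hvt' hu'
    refine ⟨k, hk, ?_, ?_⟩
    · rw [hconj]; exact hle
    · rw [hconj]; exact hnot

end Content

/-! ## §3 Representatives at depth `m`: `n(ϖ^m δ)`, `n(ϖ^{m+1} δ)` and the singular classes -/

section Representatives

variable {K : Type*} [Field K] [Valued K ℤᵐ⁰] (σ : K →+* K) {ϖ : K}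

/-- `|ϖ^j · δ| = exp(−j)` for the uniformiser of an unramified datum and a unit `δ`. [cite: Serre1979, Ch. V §2 Prop. 3] -/
theorem v_pow_mul_of_unramifiedLocalConjDatum (hd : UnramifiedLocalConjDatum σ ϖ) {δ : K} (hvδ : Valued.v δ = 1) (j : ℕ) :
    Valued.v (ϖ ^ j * δ) = WithZero.exp (-(j : ℤ)) := by
  induction j with
  | zero => rw [pow_zero, one_mul, hvδ, Nat.cast_zero, neg_zero, WithZero.exp_zero]
  | succ j ih =>
    rw [pow_succ', mul_assoc, map_mul, ih, hd.vϖ, ← WithZero.exp_add]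
    congr 1; push_cast; ring

/-- `ϖ^j · δ` is `σ`-skew when `δ` is (`σϖ = ϖ`). [cite: Rogawski1990, §3.9 p. 32] -/
theorem map_pow_mul_eq_neg_of_unramifiedLocalConjDatum (hd : UnramifiedLocalConjDatum σ ϖ) {δ : K} (hσδ : σ δ = -δ) (j : ℕ) :
    σ (ϖ ^ j * δ) = -(ϖ ^ j * δ) := by
  rw [map_mul, map_pow, hd.σϖ, hσδ, mul_neg]

/-- **THE REPRESENTATIVE `n(ϖ^j δ)`**: it lies in `U(σ, J₀)`, is integral, is square-zero (`(n − 1)² = 0`, `(n − 1)³ = 0`), and sits in the SHELL of level `j` (all entries of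
`n − 1` `≤ exp(−j)`, not all `≤ exp(−(j+1))`). [cite: Rogawski1990, §1.10 p. 9; §3.9 p. 32] -/
theorem cornerUnipotent_pow_mul_facts (hd : UnramifiedLocalConjDatum σ ϖ) {δ : K} (hσδ : σ δ = -δ) (hvδ : Valued.v δ = 1) (j : ℕ)
    {u : GL (Fin 3) K} (hu : (u : Matrix (Fin 3) (Fin 3) K) = !![1, 0, ϖ ^ j * δ; 0, 1, 0; 0, 0, 1]) :
    u ∈ unitaryGroupOfForm σ ((StdForm.antidiagonal 3).over K) ∧ IsIntMatrix (u : Matrix (Fin 3) (Fin 3) K) ∧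
      ((u : Matrix (Fin 3) (Fin 3) K) - 1) * ((u : Matrix (Fin 3) (Fin 3) K) - 1) = 0 ∧ ((u : Matrix (Fin 3) (Fin 3) K) - 1) ^ 3 = 0 ∧
      (∀ a b, Valued.v (((u : Matrix (Fin 3) (Fin 3) K) - 1) a b) ≤ WithZero.exp (-(j : ℤ))) ∧
      ¬ ∀ a b, Valued.v (((u : Matrix (Fin 3) (Fin 3) K) - 1) a b) ≤ WithZero.exp (-((j : ℤ) + 1)) := by
  have hvt := v_pow_mul_of_unramifiedLocalConjDatum σ hd hvδ j
  have hsq : ((u : Matrix (Fin 3) (Fin 3) K) - 1) * ((u : Matrix (Fin 3) (Fin 3) K) - 1) = 0 := by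
    rw [coe_cornerUnipotent_sub_one hu]
    ext a b
    fin_cases a <;> fin_cases b <;> simp [Matrix.mul_apply, Fin.sum_univ_three]
  obtain ⟨hle, hnot⟩ := forall_v_cornerUnipotent_sub_one_apply_le_and_not hvt hu
  refine ⟨(mem_unitaryGroupOfForm_iff_of_coe_eq_cornerUnipotent σ hu).2 ?_, isIntMatrix_cornerUnipotent ?_ hu, hsq, ?_, hle, hnot⟩
  · rw [map_pow_mul_eq_neg_of_unramifiedLocalConjDatum σ hd hσδ j, neg_add_cancel]
  · rw [hvt, ← WithZero.exp_zero, WithZero.exp_le_exp]; omega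
  · rw [pow_succ, pow_two, hsq, Matrix.zero_mul]

/-- **THE SINGULAR UNIPOTENT CLASSES AT DEPTH `m`: `{1}`, `[n(ϖ^m δ)]`, `[n(ϖ^{m+1} δ)]`** — every square-zero unipotent `g ∈ U(σ, J₀)` is `1`, or conjugate to `n(ϖ^m δ)`, or
to `n(ϖ^{m+1} δ)` (★ `sq_zero_unipotent_cases` gives `[n(δ)] ∕ [n(ϖδ)]`, i.e. `m = 0`; rescale inside the parity class by ★ `exists_conj_cornerUnipotent_of_v_eq_mul_exp`).  Which
of the two is the odd class `[n(ϖδ)]` is the parity of `m`. [cite: Rogawski1990, §3.9 p. 32, Prop. 3.9.1] [cite: Serre1979, Ch. V §2 Prop. 3] -/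
theorem sq_zero_unipotent_cases_level (hd : UnramifiedLocalConjDatum σ ϖ)
    (hnormU : ∀ x : K, σ x = x → Valued.v x = 1 → ∃ z : K, z * σ z = x)
    {δ : K} (hσδ : σ δ = -δ) (hvδ : Valued.v δ = 1) (m : ℕ)
    {nm nm1 : GL (Fin 3) K} (hnm : (nm : Matrix (Fin 3) (Fin 3) K) = !![1, 0, ϖ ^ m * δ; 0, 1, 0; 0, 0, 1])
    (hnm1 : (nm1 : Matrix (Fin 3) (Fin 3) K) = !![1, 0, ϖ ^ (m + 1) * δ; 0, 1, 0; 0, 0, 1])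
    {g : GL (Fin 3) K} (hg : g ∈ unitaryGroupOfForm σ ((StdForm.antidiagonal 3).over K))
    (hsq : ((g : Matrix (Fin 3) (Fin 3) K) - 1) * ((g : Matrix (Fin 3) (Fin 3) K) - 1) = 0) :
    g = 1 ∨ (∃ k : GL (Fin 3) K, k ∈ unitaryGroupOfForm σ ((StdForm.antidiagonal 3).over K) ∧ k * g * k⁻¹ = nm) ∨
      (∃ k : GL (Fin 3) K, k ∈ unitaryGroupOfForm σ ((StdForm.antidiagonal 3).over K) ∧ k * g * k⁻¹ = nm1) := by
  obtain ⟨n₀, hn₀⟩ := exists_units_coe_eq_cornerUnipotent' δ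
  obtain ⟨n₁, hn₁⟩ := exists_units_coe_eq_cornerUnipotent' (ϖ * δ)
  have hδ0 : δ ≠ 0 := fun h => by rw [h, map_zero] at hvδ; exact zero_ne_one hvδ
  have hϖ0 : ϖ ≠ 0 := hd.ϖ_ne_zero
  have hσ1 : σ (ϖ * δ) = -(ϖ * δ) := by rw [map_mul, hd.σϖ, hσδ, mul_neg]
  have hv1 : Valued.v (ϖ * δ) = WithZero.exp (-1 : ℤ) := by rw [map_mul, hd.vϖ, hvδ, mul_one]
  have hvm := v_pow_mul_of_unramifiedLocalConjDatum σ hd hvδ m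
  have hvm1 := v_pow_mul_of_unramifiedLocalConjDatum σ hd hvδ (m + 1)
  have hσm := map_pow_mul_eq_neg_of_unramifiedLocalConjDatum σ hd hσδ m
  have hσm1 := map_pow_mul_eq_neg_of_unramifiedLocalConjDatum σ hd hσδ (m + 1)
  rcases sq_zero_unipotent_cases σ hd hnormU hσδ hvδ hn₀ hn₁ hg hsq with h1 | ⟨k, hk, hkg⟩ | ⟨k, hk, hkg⟩
  · exact Or.inl h1
  · -- `g ∼ n(ϖδ)` (odd): go to the odd one among `m`, `m + 1`
    rcases Nat.even_or_odd m with ⟨a, ha⟩ | ⟨a, ha⟩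
    · right; right
      obtain ⟨k', hk', h'⟩ := exists_conj_cornerUnipotent_of_v_eq_mul_exp σ hd hnormU (mul_ne_zero hϖ0 hδ0) hσ1 hσm1 (-(a : ℤ))
        (by rw [hvm1, hv1, ← WithZero.exp_add]; congr 1; push_cast; omega) hn₁ hnm1
      exact ⟨k' * k, mul_mem hk' hk, by rw [← h', ← hkg]; group⟩
    · right; left
      obtain ⟨k', hk', h'⟩ := exists_conj_cornerUnipotent_of_v_eq_mul_exp σ hd hnormU (mul_ne_zero hϖ0 hδ0) hσ1 hσm (-(a : ℤ))
        (by rw [hvm, hv1, ← WithZero.exp_add]; congr 1; omega) hn₁ hnm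
      exact ⟨k' * k, mul_mem hk' hk, by rw [← h', ← hkg]; group⟩
  · -- `g ∼ n(δ)` (even): go to the even one among `m`, `m + 1`
    rcases Nat.even_or_odd m with ⟨a, ha⟩ | ⟨a, ha⟩
    · right; left
      obtain ⟨k', hk', h'⟩ := exists_conj_cornerUnipotent_of_v_eq_mul_exp σ hd hnormU hδ0 hσδ hσm (-(a : ℤ))
        (by rw [hvm, hvδ, ← WithZero.exp_zero, ← WithZero.exp_add]; congr 1; omega) hn₀ hnm
      exact ⟨k' * k, mul_mem hk' hk, by rw [← h', ← hkg]; group⟩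
    · right; right
      obtain ⟨k', hk', h'⟩ := exists_conj_cornerUnipotent_of_v_eq_mul_exp σ hd hnormU hδ0 hσδ hσm1 (-((a : ℤ) + 1))
        (by rw [hvm1, hvδ, ← WithZero.exp_zero, ← WithZero.exp_add]; congr 1; push_cast; omega) hn₀ hnm1
      exact ⟨k' * k, mul_mem hk' hk, by rw [← h', ← hkg]; group⟩

/-- **The two depth-`m` representatives are NOT conjugate**: no `k ∈ U(σ, J₀)` has `k n(ϖ^m δ) k⁻¹ = n(ϖ^{m+1} δ)` (parities `m`, `m + 1` differ; §2). [cite: Rogawski1990, §3.9 p. 32] -/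
theorem not_exists_conj_cornerUnipotent_pow_succ (hd : UnramifiedLocalConjDatum σ ϖ) {δ : K} (hvδ : Valued.v δ = 1) (m : ℕ)
    {nm nm1 : GL (Fin 3) K} (hnm : (nm : Matrix (Fin 3) (Fin 3) K) = !![1, 0, ϖ ^ m * δ; 0, 1, 0; 0, 0, 1])
    (hnm1 : (nm1 : Matrix (Fin 3) (Fin 3) K) = !![1, 0, ϖ ^ (m + 1) * δ; 0, 1, 0; 0, 0, 1]) :
    ¬ ∃ k : GL (Fin 3) K, k ∈ unitaryGroupOfForm σ ((StdForm.antidiagonal 3).over K) ∧ k * nm * k⁻¹ = nm1 :=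
  not_exists_conj_cornerUnipotent_of_odd σ hd.vσ (v_pow_mul_of_unramifiedLocalConjDatum σ hd hvδ m)
    (v_pow_mul_of_unramifiedLocalConjDatum σ hd hvδ (m + 1)) ⟨0, by push_cast; ring⟩ hnm hnm1

/-- The symmetric statement: `n(ϖ^{m+1} δ) ≁ n(ϖ^m δ)`. [cite: Rogawski1990, §3.9 p. 32] -/
theorem not_exists_conj_cornerUnipotent_pow_succ' (hd : UnramifiedLocalConjDatum σ ϖ) {δ : K} (hvδ : Valued.v δ = 1) (m : ℕ)
    {nm nm1 : GL (Fin 3) K} (hnm : (nm : Matrix (Fin 3) (Fin 3) K) = !![1, 0, ϖ ^ m * δ; 0, 1, 0; 0, 0, 1])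
    (hnm1 : (nm1 : Matrix (Fin 3) (Fin 3) K) = !![1, 0, ϖ ^ (m + 1) * δ; 0, 1, 0; 0, 0, 1]) :
    ¬ ∃ k : GL (Fin 3) K, k ∈ unitaryGroupOfForm σ ((StdForm.antidiagonal 3).over K) ∧ k * nm1 * k⁻¹ = nm :=
  not_exists_conj_cornerUnipotent_of_odd σ hd.vσ (v_pow_mul_of_unramifiedLocalConjDatum σ hd hvδ (m + 1))
    (v_pow_mul_of_unramifiedLocalConjDatum σ hd hvδ m) ⟨-1, by push_cast; ring⟩ hnm1 hnm

/-- **«`[n(ϖ^{m+1} δ)]` MISSES THE SHELL `m`»** — the one non-trivial vanishing of the depth-`m` RANK table: every `U(σ, J₀)`-conjugate of `n(ϖ^{m+1} δ)` of level `m` is of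
level `m + 1`. [cite: Rogawski1990, §3.9 p. 32; §8.1 p. 112] -/
theorem forall_v_conj_cornerUnipotent_pow_succ_sub_one_apply_le (hd : UnramifiedLocalConjDatum σ ϖ) {δ : K} (hvδ : Valued.v δ = 1) (m : ℕ)
    {nm1 k : GL (Fin 3) K} (hnm1 : (nm1 : Matrix (Fin 3) (Fin 3) K) = !![1, 0, ϖ ^ (m + 1) * δ; 0, 1, 0; 0, 0, 1])
    (hk : k ∈ unitaryGroupOfForm σ ((StdForm.antidiagonal 3).over K))
    (hle : ∀ i j, Valued.v ((((k * nm1 * k⁻¹ : GL (Fin 3) K) : Matrix (Fin 3) (Fin 3) K) - 1) i j) ≤ WithZero.exp (-(m : ℤ))) (i j : Fin 3) :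
    Valued.v ((((k * nm1 * k⁻¹ : GL (Fin 3) K) : Matrix (Fin 3) (Fin 3) K) - 1) i j) ≤ WithZero.exp (-((m : ℤ) + 1)) :=
  forall_v_conj_cornerUnipotent_sub_one_apply_le_exp_of_odd σ hd.vσ (v_pow_mul_of_unramifiedLocalConjDatum σ hd hvδ (m + 1)) hnm1 hk
    ⟨-1, by push_cast; ring⟩ hle i j

/-- **«`[n(ϖ^m δ)]` MISSES THE SHELL `m + 1`»** (the symmetric vanishing, needed when the pieces are ordered the other way). [cite: Rogawski1990, §3.9 p. 32; §8.1 p. 112] -/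
theorem forall_v_conj_cornerUnipotent_pow_sub_one_apply_le (hd : UnramifiedLocalConjDatum σ ϖ) {δ : K} (hvδ : Valued.v δ = 1) (m : ℕ)
    {nm k : GL (Fin 3) K} (hnm : (nm : Matrix (Fin 3) (Fin 3) K) = !![1, 0, ϖ ^ m * δ; 0, 1, 0; 0, 0, 1])
    (hk : k ∈ unitaryGroupOfForm σ ((StdForm.antidiagonal 3).over K))
    (hle : ∀ i j, Valued.v ((((k * nm * k⁻¹ : GL (Fin 3) K) : Matrix (Fin 3) (Fin 3) K) - 1) i j) ≤ WithZero.exp (-((m : ℤ) + 1))) (i j : Fin 3) :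
    Valued.v ((((k * nm * k⁻¹ : GL (Fin 3) K) : Matrix (Fin 3) (Fin 3) K) - 1) i j) ≤ WithZero.exp (-((m : ℤ) + 1 + 1)) :=
  forall_v_conj_cornerUnipotent_sub_one_apply_le_exp_of_odd σ hd.vσ (v_pow_mul_of_unramifiedLocalConjDatum σ hd hvδ m) hnm hk
    ⟨0, by push_cast; ring⟩ hle i j

end Representatives

end Literature.NumberTheory.Automorphic.UnitaryGroup
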